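import Mathlib
import Literature.Computability.AlgebraicComplexity.PermanentIrreducible
import Literature.Computability.AlgebraicComplexity.StandardFamiliesProofs
import Summits.ValiantsHypothesis.ValiantsHypothesis.Theorems.DivisionGapPerCofactorDegreeReductionStubAdditiveCreation

/-!
# Crux `DivisionGap.PerCofactorDegreeReduction` (stmt-ValiantsHypothesis-15046), line `Sketch` —
# stub `stub_equalWeightProportional`: monomials of equal weight in tied light gates are
# positively proportional modulo the permanent

**Theorem (`stub_equalWeightProportional`).** Let `n ≥ 1`, `P := per_n ∈ ℝ[x_ij]` (`n × n`
variables), let `L₀, L₁, L₂ ∈ ℝ[x]` with `P ∤ Lᵢ`, weights `e₀, e₁, e₂ ≥ 1`, and suppose the gates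
are pairwise TIED modulo `P` by binomials with positive constants:
`P ∣ Lᵢ^{e_j/g} − μᵢⱼ · L_j^{eᵢ/g}` with `g = gcd(eᵢ, e_j)` and `μᵢⱼ > 0`, for all `i, j`.  Then any
two monomials `L^α = ∏ Lᵢ^{αᵢ}`, `L^β` of equal weight `Σ αᵢeᵢ = Σ βᵢeᵢ` are positively
proportional modulo `P`: `P ∣ L^α − ρ · L^β` for some real `ρ > 0`.

## Proof

`P` is prime (`AdditiveCreation.perPoly_prime`), so `Q := ℝ[x]/(P)` is a domain; let `xᵢ ≠ 0` be
the class of `Lᵢ` and write `u ≈ v` (for `u, v ∈ Q`) when `u = ρ̄ · v` for a positive real `ρ`.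
This relation is reflexive, symmetric (`ρ ↦ ρ⁻¹`), transitive (`ρρ'`), multiplicative, stable
under powers and finite products, and — `Q` being a domain — cancellative: if `a ≠ 0`, `a ≈ b` and
`a·u ≈ b·v` then `u ≈ v` (`rel_of_rel_mul`).
* *Content reduction.* Write `e = G · e'` with `G = gcd(e₀, e₁, e₂) ≥ 1` and
  `gcd(e'₀, e'₁, e'₂) = 1` (`exists_eq_mul_coprime`).  The reduced exponents are unchanged,
  `e_j / gcd(eᵢ, e_j) = e'_j / gcd(e'ᵢ, e'_j)` (`mul_div_gcd_mul`), and
  `Σ αᵢeᵢ = Σ βᵢeᵢ ⇔ Σ αᵢe'ᵢ = Σ βᵢe'ᵢ`; so we may work with `e'`.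
* *Full ties.* Raising the tie `xᵢ^{e'_k/g} ≈ x_k^{e'ᵢ/g}` to the `g`-th power
  (`g = gcd(e'ᵢ, e'_k)`) gives `xᵢ^{e'_k} ≈ x_k^{e'ᵢ}`.
* *Weights.* For `u := ∏ xᵢ^{αᵢ}` and each `k`:
  `u^{e'_k} = ∏ᵢ (xᵢ^{e'_k})^{αᵢ} ≈ ∏ᵢ (x_k^{e'ᵢ})^{αᵢ} = x_k^{W}` with `W = Σ αᵢe'ᵢ`
  (`rel_prod_pow`); likewise `v^{e'_k} ≈ x_k^{W}` for `v := ∏ xᵢ^{βᵢ}` (same `W`).  Hence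
  `u^{e'_k} ≈ v^{e'_k}` for `k = 0, 1, 2`.
* *gcd descent (Euclid).* If `u ≠ 0`, `u^a ≈ v^a` and `u^b ≈ v^b` then
  `u^{gcd(a,b)} ≈ v^{gcd(a,b)}` (`rel_pow_gcd`): with `b = qa + r`, `u^{qa} ≈ v^{qa}` and
  `u^{qa} · u^r = u^b ≈ v^b = v^{qa} · v^r`, cancel `u^{qa}`, and recurse on `(r, a)`.
  So `u^{gcd(e'₀,e'₁,e'₂)} ≈ v^{gcd(e'₀,e'₁,e'₂)}`, i.e. `u ≈ v`, which unfolds to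
  `P ∣ L^α − C ρ · L^β` with `ρ > 0`.
(This is the multiplicative form of the lattice fact that `{κ ∈ ℤ³ : κ · e = 0}` is spanned by
the tie vectors `(e_j εᵢ − eᵢ ε_j)/gcd(eᵢ, e_j)`.)

Leans on the tree only: `AdditiveCreation.perPoly_prime`; Mathlib.  No definitions.
-/

noncomputable section

-- `Summit.ValiantsHypothesis.ValiantsHypothesis.…` is the tree's mandated single-conjunct layout
-- (Problem = Summit), so the duplicated namespace component is intended.
set_option linter.dupNamespace false

namespace Summit.ValiantsHypothesis.ValiantsHypothesis.Theorems.DivisionGap.PerCofactorDegreeReduction.EqualWeightProportional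

open MvPolynomial Literature.Computability.AlgebraicComplexity
open scoped BigOperators

/-! ### Positive proportionality `u ≈ v :⇔ u = c(ρ) · v, ρ > 0` in a ring with real constants -/

section PosRel

variable {S : Type*} [CommRing S] (c : ℝ →+* S)

/-- `≈` is reflexive (`ρ = 1`). [folklore] -/
theorem rel_refl (u : S) : ∃ ρ : ℝ, 0 < ρ ∧ u = c ρ * u :=
  ⟨1, one_pos, by rw [map_one, one_mul]⟩

variable {c}

/-- `≈` is symmetric (`ρ ↦ ρ⁻¹`). [folklore] -/
theorem rel_symm {u v : S} (h : ∃ ρ : ℝ, 0 < ρ ∧ u = c ρ * v) :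
    ∃ ρ : ℝ, 0 < ρ ∧ v = c ρ * u := by
  obtain ⟨ρ, hρ, rfl⟩ := h
  refine ⟨ρ⁻¹, inv_pos.2 hρ, ?_⟩
  rw [← mul_assoc, ← map_mul, inv_mul_cancel₀ hρ.ne', map_one, one_mul]

/-- `≈` is transitive (`ρρ'`). [folklore] -/
theorem rel_trans {u v w : S} (h₁ : ∃ ρ : ℝ, 0 < ρ ∧ u = c ρ * v)
    (h₂ : ∃ ρ : ℝ, 0 < ρ ∧ v = c ρ * w) : ∃ ρ : ℝ, 0 < ρ ∧ u = c ρ * w := by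
  obtain ⟨ρ, hρ, rfl⟩ := h₁
  obtain ⟨ρ', hρ', rfl⟩ := h₂
  exact ⟨ρ * ρ', mul_pos hρ hρ', by rw [map_mul, mul_assoc]⟩

/-- `≈` is multiplicative. [folklore] -/
theorem rel_mul {u v u' v' : S} (h₁ : ∃ ρ : ℝ, 0 < ρ ∧ u = c ρ * v)
    (h₂ : ∃ ρ : ℝ, 0 < ρ ∧ u' = c ρ * v') : ∃ ρ : ℝ, 0 < ρ ∧ u * u' = c ρ * (v * v') := by
  obtain ⟨ρ, hρ, rfl⟩ := h₁
  obtain ⟨ρ', hρ', rfl⟩ := h₂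
  exact ⟨ρ * ρ', mul_pos hρ hρ', by rw [map_mul]; ring⟩

/-- `≈` is stable under powers. [folklore] -/
theorem rel_pow {u v : S} (h : ∃ ρ : ℝ, 0 < ρ ∧ u = c ρ * v) (k : ℕ) :
    ∃ ρ : ℝ, 0 < ρ ∧ u ^ k = c ρ * v ^ k := by
  obtain ⟨ρ, hρ, rfl⟩ := h
  exact ⟨ρ ^ k, pow_pos hρ k, by rw [map_pow, mul_pow]⟩

/-- `≈` is stable under finite products. [folklore] -/
theorem rel_prod {ι : Type*} (s : Finset ι) {f g : ι → S}
    (h : ∀ i ∈ s, ∃ ρ : ℝ, 0 < ρ ∧ f i = c ρ * g i) :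
    ∃ ρ : ℝ, 0 < ρ ∧ ∏ i ∈ s, f i = c ρ * ∏ i ∈ s, g i := by
  classical
  induction s using Finset.induction_on with
  | empty => exact ⟨1, one_pos, by rw [Finset.prod_empty, Finset.prod_empty, map_one, one_mul]⟩
  | insert a s ha ih =>
    rw [Finset.prod_insert ha, Finset.prod_insert ha]
    exact rel_mul (h a (Finset.mem_insert_self a s))
      (ih fun i hi => h i (Finset.mem_insert_of_mem hi))

/-- **Weights along full ties.** If `xᵢ^{e_k} ≈ x_k^{eᵢ}` for all `i`, then
`(∏ᵢ xᵢ^{αᵢ})^{e_k} ≈ x_k^{Σ αᵢeᵢ}`. [folklore] -/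
theorem rel_prod_pow {x : Fin 3 → S} {e : Fin 3 → ℕ} (k : Fin 3)
    (T : ∀ i, ∃ ρ : ℝ, 0 < ρ ∧ x i ^ e k = c ρ * x k ^ e i) (α : Fin 3 → ℕ) :
    ∃ ρ : ℝ, 0 < ρ ∧ (∏ i, x i ^ α i) ^ e k = c ρ * x k ^ (∑ i, α i * e i) := by
  have h1 : (∏ i, x i ^ α i) ^ e k = ∏ i, (x i ^ e k) ^ α i := by
    rw [← Finset.prod_pow]
    refine Finset.prod_congr rfl fun i _ => ?_
    rw [← pow_mul, ← pow_mul, mul_comm]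
  have h2 : x k ^ (∑ i, α i * e i) = ∏ i, (x k ^ e i) ^ α i := by
    rw [← Finset.prod_pow_eq_pow_sum]
    refine Finset.prod_congr rfl fun i _ => ?_
    rw [← pow_mul, mul_comm]
  rw [h1, h2]
  exact rel_prod _ fun i _ => rel_pow (T i) _

variable [IsDomain S]

/-- **Cancellation.** In a domain: `a ≠ 0`, `a ≈ b`, `a·u ≈ b·v` imply `u ≈ v`. [folklore] -/
theorem rel_of_rel_mul {a b u v : S} (ha : a ≠ 0) (h₁ : ∃ ρ : ℝ, 0 < ρ ∧ a = c ρ * b)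
    (h₂ : ∃ ρ : ℝ, 0 < ρ ∧ a * u = c ρ * (b * v)) : ∃ ρ : ℝ, 0 < ρ ∧ u = c ρ * v := by
  obtain ⟨ρ₁, hρ₁, h₁⟩ := h₁
  obtain ⟨ρ₂, hρ₂, h₂⟩ := h₂
  refine ⟨ρ₂ / ρ₁, div_pos hρ₂ hρ₁, mul_left_cancel₀ ha ?_⟩
  have hc : c ρ₂ = c (ρ₂ / ρ₁) * c ρ₁ := by rw [← map_mul, div_mul_cancel₀ ρ₂ hρ₁.ne']
  rw [h₂, hc, h₁]
  ring

/-- **gcd descent (Euclid).** In a domain: if `u ≠ 0`, `u^a ≈ v^a` and `u^b ≈ v^b`, then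
`u^{gcd(a,b)} ≈ v^{gcd(a,b)}`. [folklore] -/
theorem rel_pow_gcd {u v : S} (hu : u ≠ 0) :
    ∀ a b : ℕ, (∃ ρ : ℝ, 0 < ρ ∧ u ^ a = c ρ * v ^ a) → (∃ ρ : ℝ, 0 < ρ ∧ u ^ b = c ρ * v ^ b) →
      ∃ ρ : ℝ, 0 < ρ ∧ u ^ Nat.gcd a b = c ρ * v ^ Nat.gcd a b := fun a b => by
  induction a, b using Nat.gcd.induction with
  | H0 n =>
    intro _ hb
    rwa [Nat.gcd_zero_left]
  | H1 m n _ ih =>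
    intro ha hb
    rw [Nat.gcd_rec]
    refine ih ?_ ha
    have hn : n = m * (n / m) + n % m := (Nat.div_add_mod n m).symm
    have key : ∃ ρ : ℝ, 0 < ρ ∧ u ^ (m * (n / m)) = c ρ * v ^ (m * (n / m)) := by
      rw [pow_mul, pow_mul]
      exact rel_pow ha _
    refine rel_of_rel_mul (pow_ne_zero _ hu) key ?_
    rw [← pow_add, ← pow_add, ← hn]
    exact hb

/-- **The coprime case.** In a domain: if `xᵢ ≠ 0`, `gcd(e₀, e₁, e₂) = 1`, `xᵢ^{e_k} ≈ x_k^{eᵢ}` for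
all `i, k`, and `Σ αᵢeᵢ = Σ βᵢeᵢ`, then `∏ xᵢ^{αᵢ} ≈ ∏ xᵢ^{βᵢ}`. [folklore] -/
theorem rel_of_weight_eq_coprime {x : Fin 3 → S} (hx : ∀ i, x i ≠ 0) {e : Fin 3 → ℕ}
    (hG : Nat.gcd (Nat.gcd (e 0) (e 1)) (e 2) = 1)
    (T : ∀ i k, ∃ ρ : ℝ, 0 < ρ ∧ x i ^ e k = c ρ * x k ^ e i) {α β : Fin 3 → ℕ}
    (hαβ : ∑ i, α i * e i = ∑ i, β i * e i) :
    ∃ ρ : ℝ, 0 < ρ ∧ ∏ i, x i ^ α i = c ρ * ∏ i, x i ^ β i := by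
  have hu : (∏ i, x i ^ α i) ≠ 0 := Finset.prod_ne_zero_iff.2 fun i _ => pow_ne_zero _ (hx i)
  have hk : ∀ k, ∃ ρ : ℝ, 0 < ρ ∧
      (∏ i, x i ^ α i) ^ e k = c ρ * (∏ i, x i ^ β i) ^ e k := fun k =>
    rel_trans (rel_prod_pow k (fun i => T i k) α)
      (by rw [hαβ]; exact rel_symm (rel_prod_pow k (fun i => T i k) β))
  have h := rel_pow_gcd hu _ _ (rel_pow_gcd hu _ _ (hk 0) (hk 1)) (hk 2)
  rwa [hG, pow_one, pow_one] at h

end PosRel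

/-! ### Arithmetic of the content reduction -/

/-- Extracting the content of a weight vector: `e = G · e'` with `G ≥ 1` and
`gcd(e'₀, e'₁, e'₂) = 1` (only `e₂ ≥ 1` is needed). [folklore] -/
theorem exists_eq_mul_coprime (e : Fin 3 → ℕ) (he : 0 < e 2) :
    ∃ (G : ℕ) (e' : Fin 3 → ℕ), 0 < G ∧ Nat.gcd (Nat.gcd (e' 0) (e' 1)) (e' 2) = 1 ∧
      ∀ i, e i = G * e' i := by
  have h0 : Nat.gcd (Nat.gcd (e 0) (e 1)) (e 2) ∣ e 0 :=
    (Nat.gcd_dvd_left _ _).trans (Nat.gcd_dvd_left _ _)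
  have h1 : Nat.gcd (Nat.gcd (e 0) (e 1)) (e 2) ∣ e 1 :=
    (Nat.gcd_dvd_left _ _).trans (Nat.gcd_dvd_right _ _)
  have h2 : Nat.gcd (Nat.gcd (e 0) (e 1)) (e 2) ∣ e 2 := Nat.gcd_dvd_right _ _
  have hpos : 0 < Nat.gcd (Nat.gcd (e 0) (e 1)) (e 2) := Nat.gcd_pos_of_pos_right _ he
  refine ⟨_, fun i => e i / Nat.gcd (Nat.gcd (e 0) (e 1)) (e 2), hpos, ?_, fun i => ?_⟩
  · show Nat.gcd (Nat.gcd (e 0 / _) (e 1 / _)) (e 2 / _) = 1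
    rw [Nat.gcd_div h0 h1, Nat.gcd_div (Nat.dvd_gcd h0 h1) h2, Nat.div_self hpos]
  · refine (Nat.mul_div_cancel' ?_).symm
    fin_cases i
    · exact h0
    · exact h1
    · exact h2

/-- The reduced exponents do not see the content: `G b / gcd(G a, G b) = b / gcd(a, b)` for
`G ≥ 1`. [folklore] -/
theorem mul_div_gcd_mul {G : ℕ} (a b : ℕ) (hG : 0 < G) :
    G * b / Nat.gcd (G * a) (G * b) = b / Nat.gcd a b := by
  rw [Nat.gcd_mul_left, Nat.mul_div_mul_left _ _ hG]

/-! ### The theorem -/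

/-- **stub_equalWeightProportional — EQUAL-WEIGHT MONOMIALS IN TIED GATES ARE POSITIVELY
PROPORTIONAL.**  For `n ≥ 1`, gates `L₀, L₁, L₂ ∉ (per_n)` with weights `eᵢ ≥ 1`, pairwise tied
modulo `per_n` by `Lᵢ^{e_j/g} ≡ μᵢⱼ L_j^{eᵢ/g}` (`g = gcd(eᵢ,e_j)`, `μᵢⱼ > 0`), and exponent vectors
`α, β` with `Σ αᵢeᵢ = Σ βᵢeᵢ`: `per_n ∣ L^α − C ρ · L^β` for some real `ρ > 0`.  Proof in the
domain `ℝ[x]/(per_n)`: reduce to `gcd(e) = 1`, raise the ties to full ties `xᵢ^{e_k} ≈ x_k^{eᵢ}`,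
get `u^{e_k} ≈ x_k^W ≈ v^{e_k}` for `u = x^α`, `v = x^β`, and descend along Euclid's algorithm to
`u^{gcd(e)} ≈ v^{gcd(e)}` (`rel_of_weight_eq_coprime`). [folklore] -/
theorem stub_equalWeightProportional (n : ℕ) (hn : 1 ≤ n) (e : Fin 3 → ℕ) (he : ∀ i, 1 ≤ e i)
    (L : Fin 3 → MvPolynomial (Fin n × Fin n) ℝ)
    (hL : ∀ i, ¬ perPoly (Fin n) ℝ ∣ L i)
    (μ : Fin 3 → Fin 3 → ℝ) (hμ : ∀ i j, 0 < μ i j)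
    (htie : ∀ i j, perPoly (Fin n) ℝ ∣
      L i ^ (e j / Nat.gcd (e i) (e j)) - C (μ i j) * L j ^ (e i / Nat.gcd (e i) (e j)))
    (α β : Fin 3 → ℕ) (hαβ : ∑ i, α i * e i = ∑ i, β i * e i) :
    ∃ ρ : ℝ, 0 < ρ ∧ perPoly (Fin n) ℝ ∣ (∏ i, L i ^ α i) - C ρ * ∏ i, L i ^ β i := by
  have hprime : Prime (perPoly (Fin n) ℝ) := AdditiveCreation.perPoly_prime hn
  -- the quotient domain `Q = ℝ[x]/(P)` and the quotient map `π`
  haveI : IsDomain (MvPolynomial (Fin n × Fin n) ℝ ⧸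
      Ideal.span ({perPoly (Fin n) ℝ} : Set (MvPolynomial (Fin n × Fin n) ℝ))) :=
    (Ideal.Quotient.isDomain_iff_prime _).mpr
      ((Ideal.span_singleton_prime hprime.ne_zero).mpr hprime)
  obtain ⟨π, hπdef⟩ : ∃ π : MvPolynomial (Fin n × Fin n) ℝ →+* MvPolynomial (Fin n × Fin n) ℝ ⧸
      Ideal.span ({perPoly (Fin n) ℝ} : Set (MvPolynomial (Fin n × Fin n) ℝ)),
      π = Ideal.Quotient.mk _ := ⟨_, rfl⟩
  have hπ0 : ∀ a, π a = 0 ↔ perPoly (Fin n) ℝ ∣ a := fun a => by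
    rw [hπdef, Ideal.Quotient.eq_zero_iff_mem, Ideal.mem_span_singleton]
  have hx : ∀ i, π (L i) ≠ 0 := fun i h => hL i ((hπ0 _).1 h)
  -- content reduction `e = G • e'`
  obtain ⟨G, e', hG0, hG1, he'⟩ := exists_eq_mul_coprime e (he 2)
  have hαβ' : ∑ i, α i * e' i = ∑ i, β i * e' i := by
    have h3 : ∀ γ : Fin 3 → ℕ, ∑ i, γ i * e i = G * ∑ i, γ i * e' i := fun γ => by
      rw [Finset.mul_sum]
      exact Finset.sum_congr rfl fun i _ => by rw [he' i]; ring
    have h4 := hαβ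
    rw [h3 α, h3 β] at h4
    exact Nat.eq_of_mul_eq_mul_left hG0 h4
  -- full ties `xᵢ^{e'_k} ≈ x_k^{e'ᵢ}`
  have T : ∀ i k, ∃ ρ : ℝ, 0 < ρ ∧
      π (L i) ^ e' k = (π.comp C) ρ * π (L k) ^ e' i := by
    intro i k
    have h2 := (hπ0 _).2 (htie i k)
    rw [map_sub, map_mul, map_pow, map_pow, sub_eq_zero, he' i, he' k,
      mul_div_gcd_mul _ _ hG0, Nat.gcd_comm (G * e' i), mul_div_gcd_mul _ _ hG0,
      Nat.gcd_comm (e' k)] at h2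
    have h3 := rel_pow (c := π.comp C) ⟨μ i k, hμ i k, h2⟩ (Nat.gcd (e' i) (e' k))
    rwa [← pow_mul, ← pow_mul, Nat.div_mul_cancel (Nat.gcd_dvd_right _ _),
      Nat.div_mul_cancel (Nat.gcd_dvd_left _ _)] at h3
  -- the coprime case, and back to divisibility
  obtain ⟨ρ, hρ, h⟩ := rel_of_weight_eq_coprime (x := fun i => π (L i)) hx hG1 T hαβ'
  refine ⟨ρ, hρ, (hπ0 _).1 ?_⟩
  rw [map_sub, map_mul, map_prod, map_prod, sub_eq_zero]
  simpa only [map_pow, RingHom.comp_apply] using h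

end Summit.ValiantsHypothesis.ValiantsHypothesis.Theorems.DivisionGap.PerCofactorDegreeReduction.EqualWeightProportional

end
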